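import Summits.ValiantsHypothesis.ValiantsHypothesis.Theorems.KPlusLogSqLawTropicalBWalkDesignStructure
import Summits.ValiantsHypothesis.ValiantsHypothesis.Theorems.KPlusLogSqLawTropicalBWalkWidthPaths

/-!
# Route `KPlusLogSqLaw`, crux `TropicalB` (stmt-ValiantsHypothesis-19771) — the NARROW-WALK SECTOR LAW, part 2:
# a walk design of width `W = |V|` carries at most `1 + W·(2W)^{⌈log₂ T⌉}` dominant chain terms (Gusfield by WIDTH)

HONEST FRAMING.  Def-free helper (sector law; hand leafhand-val-kpluslogsqlaw-1 g33, 2026-09-01; `--supports stmt-ValiantsHypothesis-19771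
--as helper`) toward the registered stubs `stub_tropThin` / `stub_tropFat` / `stub_tropTowerLog` of `Cruxes/TropicalB/Lines/birth.lean`.  It bounds
the census of ONE family of designs — the WALK DESIGNS of `…TropicalBWalkDesignDefs` (layered graph `lay : Fin T → V → V → Option (WEdge K)`,
start `v₀`, padding class `l₀`, bonus `Ω`, rows `Fin (T+1) × V ≃ Fin m`), the family carrying every super-polynomial lower bound the route
knows (staircase / Carstensen–Mulmuley–Shah) — by the WIDTH `W = |V|`: every chain of dominant terms at strictly increasing integer slopes with
distinct consecutive terms has at most `1 + W·(2W)^{⌈log₂ T⌉}` terms (`chain_le_width`, signed form `chain_le_width_signed`), for EVERY class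
count `K` and exponent table `d`.  So a width-`W` walk family has `m`-exponent at most `1 + log₂ W` (rows `m = (T+1)·W`): exponentially sharper
in `W` than the cut-width sector law `…TropicalBCutwidth` (exponent `w + 1`, `w ≈ 2W` here) and `K`-free; in particular a cubic `K = 4` WALK
family (the cell's fork `¬ TropK4Law 2`) needs width `≥ 4`, and a counting-tight `K`-column walk family needs width `≥ 2^{K−2}`.  Nothing here
bounds `TropicalB` on general supports; nothing bears on `WeakLifting`, `MatrixDescartes` (stmt-ValiantsHypothesis-18050) or VP ≠ VNP.

THE ARGUMENT.  (1) `present_cases` / `tropWeight_walkTerm` (tree): a present term is the identity term or a walk term, of weight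
`(m − T)·θ·d l₀ + Ω − walkCostFin θ y`; so a DOMINANT walk is strictly cheapest (`cost_lt_of_isDominant`), and its cost line is the unique
lowest line at `θ` of the DAG line set of its last vertex (`slope_mem_pieceSlopes`, via part 1's `reach_of_pwalk` / `exists_pwalk_of_reach`).
(2) Dominant chain terms are pairwise distinct (`chain_injective`: dominance regions are intervals) and distinct dominant walks have distinct
envelope slopes (`eq_of_slope_eq`), so the chain injects into `{identity} ⊔ ⋃_x pieceSlopes(W u x N)`.  (3) The Literature width recursion
`ParamDAG.Pmax_two_pow_le_of_isLayering` (Gusfield/Dean with the layer width as base, Gajjar–Radhakrishnan 2019 §1.2) bounds each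
`#pieceSlopes` by `(2W)^{⌈log₂ T⌉}`.  The DAG, the numbering and the cost functional are built INSIDE the proof of `chain_le_width` (no new
definitions; part 1 states the interface).  [folklore: Gusfield 1980 / Dean (Nikolova 2009, Lemma 6.1.7) / Gajjar–Radhakrishnan 2019 §1.2,
in the dominance vocabulary]
-/

set_option linter.dupNamespace false
set_option autoImplicit false

namespace Summit.ValiantsHypothesis.ValiantsHypothesis.Theorems.KPlusLogSqLaw.WalkDesign

open Summit.ValiantsHypothesis.ValiantsHypothesis.Theorems.MatrixDescartes.Negative
open Summit.ValiantsHypothesis.ValiantsHypothesis.Theorems.SymmetroidDescartes.DPR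
open Literature.Combinatorics.Optimization
open scoped BigOperators
open Finset

section Chains

variable {V : Type*} [DecidableEq V] [Fintype V] {T K : ℕ} (lay : Fin T → V → V → Option (WEdge K)) (d : Fin K → ℕ)
  (v₀ : V) (l₀ : Fin K) {m : ℕ} (ι : Fin (T + 1) × V ≃ Fin m) (Ω : ℤ)

omit [Fintype V] in
/-- the walk term determines the walk (`T > 0`: every layer point of the walk is moved). [folklore] -/
theorem eq_of_walkTerm_eq (hT : 0 < T) {y y' : Fin (T + 1) → V} (h : walkTerm ι lay l₀ y = walkTerm ι lay l₀ y') :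
    y = y' := by
  have hperm : ∀ c, walkPerm y c = walkPerm y' c := by
    intro c
    have := Equiv.congr_fun (congrArg Prod.fst h) (ι c)
    simpa [walkTerm] using this
  funext t
  have h1 : walkPerm y (t, y t) ≠ (t, y t) := (walkPerm_ne_iff y hT (t, y t)).2 rfl
  rw [hperm] at h1
  exact ((walkPerm_ne_iff y' hT (t, y t)).1 h1).symm ▸ rfl

/-- **A dominant walk is strictly cheapest**: if the walk term of `y` is the unique optimum at `θ`, every other walk from `v₀`
costs strictly more at `θ`. [folklore] -/
theorem cost_lt_of_isDominant (hT : 0 < T) {θ : ℤ} {y y' : Fin (T + 1) → V} (hy : IsLayWalk lay v₀ y)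
    (hy' : IsLayWalk lay v₀ y') (hne : y' ≠ y)
    (hdom : IsDominant d (walkVal ι lay Ω v₀) (walkEps ι lay l₀ v₀) θ (walkTerm ι lay l₀ y)) :
    walkCostFin d lay θ y < walkCostFin d lay θ y' := by
  have hne' : walkTerm ι lay l₀ y' ≠ walkTerm ι lay l₀ y := fun h => hne (eq_of_walkTerm_eq lay l₀ ι hT h)
  have hlt := hdom.2 _ hne' (termSign_walkTerm_ne_zero ι lay l₀ v₀ hT hy')
  rw [tropWeight_walkTerm ι d lay l₀ Ω v₀ θ hT hy', tropWeight_walkTerm ι d lay l₀ Ω v₀ θ hT hy] at hlt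
  linarith

/-- **Dominant chains have pairwise distinct terms** (a term dominant at `θ_i` and `θ_j` is dominant in between, where a
different term sits; weights are affine in `θ`). [folklore] -/
theorem chain_injective {mm KK : ℕ} (dd : Fin KK → ℕ) (vv εε : Fin mm → Fin mm → Fin KK → ℤ) {n : ℕ}
    (θ : Fin (n + 1) → ℤ) (p : Fin (n + 1) → Equiv.Perm (Fin mm) × (Fin mm → Fin KK)) (hθ : StrictMono θ)
    (hdom : ∀ k, IsDominant dd vv εε (θ k) (p k)) (hne : ∀ k : Fin n, p k.castSucc ≠ p k.succ) :
    Function.Injective p := by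
  have key : ∀ i j : Fin (n + 1), i < j → p i = p j → False := by
    intro i j hij hpij
    have hi : (i : ℕ) < n := by have := j.isLt; omega
    set k : Fin n := ⟨i, hi⟩ with hk
    have hkc : k.castSucc = i := Fin.ext rfl
    by_cases hq : p k.succ = p i
    · exact hne k (by rw [hkc, hq])
    have hpres_q : termSign εε (p k.succ) ≠ 0 := (hdom k.succ).1
    have hpres_i : termSign εε (p i) ≠ 0 := (hdom i).1
    have a1 := (hdom i).2 _ hq hpres_q
    have a2 := (hdom j).2 _ (by rw [← hpij]; exact hq) hpres_q
    have a3 := (hdom k.succ).2 _ (Ne.symm hq) hpres_i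
    rw [← hpij] at a2
    have t1 : θ i < θ k.succ := by rw [← hkc]; exact hθ (Fin.castSucc_lt_succ)
    have t2 : θ k.succ ≤ θ j := hθ.monotone (by rw [Fin.le_def]; simp [hk]; omega)
    unfold tropWeight at a1 a2 a3
    set S := ∑ x, (dd ((p i).2 x) : ℤ) with hS
    set S' := ∑ x, (dd ((p k.succ).2 x) : ℤ) with hS'
    set A := ∑ x, vv ((p i).1 x) x ((p i).2 x) with hA
    set A' := ∑ x, vv ((p k.succ).1 x) x ((p k.succ).2 x) with hA'
    rcases le_or_gt (S' - S) 0 with hσ | hσ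
    · nlinarith
    · nlinarith
  intro i j hpij
  rcases lt_trichotomy i j with hij | rfl | hji
  · exact (key i j hij hpij).elim
  · rfl
  · exact (key j i hji hpij.symm).elim

variable {k : ℕ} (e : Fin (T + 1) × V ≃ Fin (k + 1)) (G : ParamDAG k) (EL : Option (WEdge K) → ℝ × ℝ)
  (pc : ℕ → (Fin (T + 1) → V) → ℝ × ℝ)

/-- **The slope of a dominant walk is a piece slope** of the lower envelope of the DAG line set of its last vertex: its cost line is the
unique lowest line at `θ` (generic interface of part 1 plus `hval : val (pc T y) θ = walkCostFin θ y`). [folklore] -/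
theorem slope_mem_pieceSlopes (hT : 0 < T)
    (hadj : ∀ a b, G.adj a b ↔ (layerEdge lay (e.symm a) (e.symm b)).isSome)
    (hw : ∀ a b, (G.wa a b, G.wb a b) = EL (layerEdge lay (e.symm a) (e.symm b))) (pc0 : ∀ y, pc 0 y = 0)
    (pcS : ∀ (t : ℕ) (ht : t < T) (y : Fin (T + 1) → V), pc (t + 1) y = pc t y + EL (edgeAt lay y ⟨t, ht⟩))
    (pcC : ∀ (t : ℕ) (y y' : Fin (T + 1) → V), (∀ s : Fin T, (s : ℕ) < t → edgeAt lay y' s = edgeAt lay y s) → pc t y' = pc t y)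
    (hval : ∀ (y : Fin (T + 1) → V) (θ : ℤ), Envelope.val (pc T y) (θ : ℝ) = (walkCostFin d lay θ y : ℝ))
    {θ : ℤ} {y : Fin (T + 1) → V} (hy : IsLayWalk lay v₀ y)
    (hdom : IsDominant d (walkVal ι lay Ω v₀) (walkEps ι lay l₀ v₀) θ (walkTerm ι lay l₀ y)) :
    (pc T y).2 ∈ Envelope.pieceSlopes (G.W (e (0, v₀)) (e (Fin.last T, y (Fin.last T))) (2 ^ Nat.clog 2 T)) := by
  -- the line set: lines of the walks from `v₀` ending at `y T`
  have hmem : ∀ {y' : Fin (T + 1) → V}, IsLayWalk lay v₀ y' →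
      pc T y' ∈ G.W (e (0, v₀)) (e (Fin.last T, y' (Fin.last T))) (2 ^ Nat.clog 2 T) := by
    intro y' hy'
    rw [ParamDAG.mem_W]
    exact ⟨T, Nat.le_pow_clog one_lt_two T,
      reach_of_pwalk lay e G EL pc hadj hw pc0 pcS v₀ y' hy'.1 T le_rfl (fun s _ => hy'.2 s)⟩
  have hof : ∀ {ℓ : ℝ × ℝ}, ℓ ∈ G.W (e (0, v₀)) (e (Fin.last T, y (Fin.last T))) (2 ^ Nat.clog 2 T) →
      ∃ y' : Fin (T + 1) → V, IsLayWalk lay v₀ y' ∧ ℓ = pc T y' := by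
    intro ℓ hℓ
    obtain ⟨m', -, hr⟩ := ParamDAG.mem_W.1 hℓ
    obtain ⟨y', hP, ⟨hm', hb⟩, rfl⟩ := exists_pwalk_of_reach lay e G EL pc hadj hw pc0 pcS pcC v₀ hr
    rw [Equiv.symm_apply_apply] at hb
    have hmT : m' = T := by
      have := congrArg (fun q : Fin (T + 1) × V => (q.1 : ℕ)) hb
      simpa using this.symm
    subst hmT
    exact ⟨y', ⟨hP.1, fun s => hP.2 s s.isLt⟩, rfl⟩
  rw [Envelope.mem_pieceSlopes]
  refine ⟨(θ : ℝ), ?_⟩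
  have hne : (G.W (e (0, v₀)) (e (Fin.last T, y (Fin.last T))) (2 ^ Nat.clog 2 T)).Nonempty := ⟨_, hmem hy⟩
  obtain ⟨⟨ℓ, hmin, hs⟩, -⟩ := Envelope.sMin_spec hne (θ : ℝ)
  obtain ⟨y', hy', rfl⟩ := hof hmin.1
  have hle := hmin.2 _ (hmem hy)
  rw [hval, hval] at hle
  have hyy : y' = y := by
    by_contra hne'
    have h1 := cost_lt_of_isDominant lay d v₀ l₀ ι Ω hT hy hy' hne' hdom
    have : (walkCostFin d lay θ y : ℝ) < (walkCostFin d lay θ y' : ℝ) := by exact_mod_cast h1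
    linarith
  subst hyy
  exact hs.symm

/-- **Distinct dominant walks have distinct envelope slopes**: if the walk terms of `y`, `y'` are unique optima (at `θ`, `θ'`) and their
cost lines have the same slope, then `y = y'`. [folklore] -/
theorem eq_of_slope_eq (hT : 0 < T)
    (hval : ∀ (y : Fin (T + 1) → V) (θ : ℤ), Envelope.val (pc T y) (θ : ℝ) = (walkCostFin d lay θ y : ℝ))
    {θ θ' : ℤ} {y y' : Fin (T + 1) → V} (hy : IsLayWalk lay v₀ y) (hy' : IsLayWalk lay v₀ y')
    (hd : IsDominant d (walkVal ι lay Ω v₀) (walkEps ι lay l₀ v₀) θ (walkTerm ι lay l₀ y))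
    (hd' : IsDominant d (walkVal ι lay Ω v₀) (walkEps ι lay l₀ v₀) θ' (walkTerm ι lay l₀ y'))
    (hs : (pc T y).2 = (pc T y').2) : y = y' := by
  by_contra hne
  have h1 := cost_lt_of_isDominant lay d v₀ l₀ ι Ω hT hy hy' (Ne.symm hne) hd
  have h2 := cost_lt_of_isDominant lay d v₀ l₀ ι Ω hT hy' hy hne hd'
  have h1' : (walkCostFin d lay θ y : ℝ) < (walkCostFin d lay θ y' : ℝ) := by exact_mod_cast h1
  have h2' : (walkCostFin d lay θ' y' : ℝ) < (walkCostFin d lay θ' y : ℝ) := by exact_mod_cast h2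
  rw [← hval, ← hval] at h1' h2'
  unfold Envelope.val at h1' h2'
  rw [hs] at h1' h2'
  linarith

/-- **THE NARROW-WALK SECTOR LAW.**  In the walk design of a layered graph of width `W = |V|` with `T ≥ 1` edge layers, every chain of
dominant terms at strictly increasing integer slopes with distinct consecutive terms has at most `1 + W·(2W)^{⌈log₂ T⌉}` terms — for every
class count `K`, exponent table `d`, padding class `l₀`, bonus `Ω` and row numbering `ι`.
[folklore: Gusfield/Dean's recursion with the width as base (GR19 §1.2), in the dominance vocabulary] -/
theorem chain_le_width (hT : 0 < T) {n : ℕ} (θ : Fin (n + 1) → ℤ)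
    (p : Fin (n + 1) → Equiv.Perm (Fin m) × (Fin m → Fin K)) (hθ : StrictMono θ)
    (hdom : ∀ k, IsDominant d (walkVal ι lay Ω v₀) (walkEps ι lay l₀ v₀) (θ k) (p k))
    (hne : ∀ k : Fin n, p k.castSucc ≠ p k.succ) :
    n + 1 ≤ 1 + Fintype.card V * (2 * Fintype.card V) ^ Nat.clog 2 T := by
  classical
  -- (0) the instantiation of part 1's interface: numbering, DAG, edge lines, partial costs
  have hV : 0 < Fintype.card V := Fintype.card_pos_iff.2 ⟨v₀⟩
  obtain ⟨kk, hkk⟩ : ∃ kk, (T + 1) * Fintype.card V = kk + 1 :=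
    ⟨(T + 1) * Fintype.card V - 1, (Nat.succ_pred_eq_of_pos (Nat.mul_pos (Nat.succ_pos T) hV)).symm⟩
  set e : Fin (T + 1) × V ≃ Fin (kk + 1) :=
    (((Equiv.refl (Fin (T + 1))).prodCongr (Fintype.equivFin V)).trans finProdFinEquiv).trans (finCongr hkk) with he
  have he_val : ∀ q : Fin (T + 1) × V, ((e q : Fin (kk + 1)) : ℕ) = (Fintype.equivFin V q.2 : ℕ) + Fintype.card V * (q.1 : ℕ) := by
    intro q; simp [he]
  set EL : Option (WEdge K) → ℝ × ℝ := fun o =>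
    match o with
    | some ed => ((ed.a : ℝ), -((d ed.cls : ℕ) : ℝ))
    | none => (0, 0) with hEL
  let G : ParamDAG kk :=
    { adj := fun a b => (layerEdge lay (e.symm a) (e.symm b)).isSome
      wa := fun a b => (EL (layerEdge lay (e.symm a) (e.symm b))).1
      wb := fun a b => (EL (layerEdge lay (e.symm a) (e.symm b))).2
      adj_lt := by
        intro a b hab
        obtain ⟨ed, hed⟩ := Option.isSome_iff_exists.mp hab
        have hl := layer_of_layerEdge lay hed
        rw [Fin.lt_def, ← Equiv.apply_symm_apply e a, ← Equiv.apply_symm_apply e b, he_val, he_val]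
        have h1 : ((Fintype.equivFin V (e.symm a).2 : ℕ)) < Fintype.card V := (Fintype.equivFin V (e.symm a).2).isLt
        have h2 : Fintype.card V * ((((e.symm a).1 : Fin (T + 1)) : ℕ) + 1) ≤ Fintype.card V * (((e.symm b).1 : Fin (T + 1)) : ℕ) :=
          Nat.mul_le_mul_left _ (by omega)
        rw [Nat.mul_succ] at h2
        omega }
  have hadj : ∀ a b, G.adj a b ↔ (layerEdge lay (e.symm a) (e.symm b)).isSome := fun a b => Iff.rfl
  have hw : ∀ a b, (G.wa a b, G.wb a b) = EL (layerEdge lay (e.symm a) (e.symm b)) := fun a b => rfl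
  set pc : ℕ → (Fin (T + 1) → V) → ℝ × ℝ := fun t y =>
    (∑ s : Fin T, if (s : ℕ) < t then (EL (edgeAt lay y s)).1 else 0,
     ∑ s : Fin T, if (s : ℕ) < t then (EL (edgeAt lay y s)).2 else 0) with hpc
  have pc0 : ∀ y, pc 0 y = 0 := by intro y; simp [hpc]
  have pcS : ∀ (t : ℕ) (ht : t < T) (y : Fin (T + 1) → V), pc (t + 1) y = pc t y + EL (edgeAt lay y ⟨t, ht⟩) := by
    intro t ht y
    have key : ∀ (f : Fin T → ℝ), (∑ s : Fin T, if (s : ℕ) < t + 1 then f s else 0) =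
        (∑ s : Fin T, if (s : ℕ) < t then f s else 0) + f ⟨t, ht⟩ := by
      intro f
      have hpt : ∀ s : Fin T, (if (s : ℕ) < t + 1 then f s else 0) =
          (if (s : ℕ) < t then f s else 0) + (if s = ⟨t, ht⟩ then f s else 0) := by
        intro s
        by_cases h1 : (s : ℕ) < t
        · have h2 : s ≠ ⟨t, ht⟩ := fun h => by simp [h] at h1
          simp [h1, h2, show (s : ℕ) < t + 1 by omega]
        · by_cases h3 : s = ⟨t, ht⟩
          · subst h3; simp
          · have h4 : ¬ (s : ℕ) < t + 1 := by
              intro h; apply h3; ext; simp; omega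
            simp [h1, h3, h4]
      rw [Finset.sum_congr rfl (fun s _ => hpt s), Finset.sum_add_distrib, Finset.sum_ite_eq' Finset.univ ⟨t, ht⟩ f]
      simp
    simp only [hpc]
    ext <;> simp only [Prod.fst_add, Prod.snd_add] <;> exact key _
  have pcC : ∀ (t : ℕ) (y y' : Fin (T + 1) → V), (∀ s : Fin T, (s : ℕ) < t → edgeAt lay y' s = edgeAt lay y s) →
      pc t y' = pc t y := by
    intro t y y' h
    simp only [hpc, Prod.mk.injEq]
    constructor
    · refine Finset.sum_congr rfl fun s _ => ?_
      by_cases hs : (s : ℕ) < t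
      · rw [if_pos hs, if_pos hs, h s hs]
      · rw [if_neg hs, if_neg hs]
    · refine Finset.sum_congr rfl fun s _ => ?_
      by_cases hs : (s : ℕ) < t
      · rw [if_pos hs, if_pos hs, h s hs]
      · rw [if_neg hs, if_neg hs]
  have hval : ∀ (y : Fin (T + 1) → V) (θ' : ℤ), Envelope.val (pc T y) (θ' : ℝ) = (walkCostFin d lay θ' y : ℝ) := by
    intro y θ'
    simp only [hpc, Envelope.val, walkCostFin, Fin.is_lt, if_true]
    rw [Finset.sum_mul, ← Finset.sum_add_distrib]
    push_cast
    refine Finset.sum_congr rfl fun s _ => ?_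
    cases edgeAt lay y s with
    | none => simp [hEL]
    | some ed => simp only [hEL]; push_cast; ring
  -- (1) the chain terms: pairwise distinct; identity or walk terms
  have hinj := chain_injective d (walkVal ι lay Ω v₀) (walkEps ι lay l₀ v₀) θ p hθ hdom hne
  have hwalk : ∀ j, p j ≠ idTerm l₀ → ∃ y, IsLayWalk lay v₀ y ∧ p j = walkTerm ι lay l₀ y :=
    fun j hj => (present_cases lay l₀ v₀ ι hT (p j) (hdom j).1).resolve_left hj
  let ysel : Fin (n + 1) → Fin (T + 1) → V := fun j =>
    if hj : p j ≠ idTerm l₀ then Classical.choose (hwalk j hj) else fun _ => v₀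
  have hysel : ∀ j (hj : p j ≠ idTerm l₀), IsLayWalk lay v₀ (ysel j) ∧ p j = walkTerm ι lay l₀ (ysel j) := by
    intro j hj
    have := Classical.choose_spec (hwalk j hj)
    simp only [ysel, dif_pos hj]
    exact this
  set S := Finset.univ.filter fun j : Fin (n + 1) => p j ≠ idTerm l₀ with hS
  set S₀ := Finset.univ.filter fun j : Fin (n + 1) => ¬ p j ≠ idTerm l₀ with hS₀
  have hS₀card : S₀.card ≤ 1 := by
    refine Finset.card_le_one.2 fun a ha b hb => ?_
    simp only [hS₀, Finset.mem_filter, Finset.mem_univ, true_and, not_not] at ha hb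
    exact hinj (ha.trans hb.symm)
  -- (2) the slope map: walk-indices ↪ the union of the piece-slope sets of the end vertices
  set U := (Finset.univ : Finset V).biUnion fun x =>
    Envelope.pieceSlopes (G.W (e (0, v₀)) (e (Fin.last T, x)) (2 ^ Nat.clog 2 T)) with hU
  have hmaps : ∀ j ∈ S, (pc T (ysel j)).2 ∈ U := by
    intro j hj
    have hj' : p j ≠ idTerm l₀ := (Finset.mem_filter.1 hj).2
    obtain ⟨hy, hpj⟩ := hysel j hj'
    rw [hU, Finset.mem_biUnion]
    refine ⟨ysel j (Fin.last T), Finset.mem_univ _, ?_⟩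
    exact slope_mem_pieceSlopes lay d v₀ l₀ ι Ω e G EL pc hT hadj hw pc0 pcS pcC hval hy (hpj ▸ hdom j)
  have hinjS : Set.InjOn (fun j => (pc T (ysel j)).2) ↑S := by
    intro a ha b hb hab
    have ha' : p a ≠ idTerm l₀ := (Finset.mem_filter.1 ha).2
    have hb' : p b ≠ idTerm l₀ := (Finset.mem_filter.1 hb).2
    obtain ⟨hya, hpa⟩ := hysel a ha'
    obtain ⟨hyb, hpb⟩ := hysel b hb'
    have hyy := eq_of_slope_eq lay d v₀ l₀ ι Ω pc hT hval hya hyb (hpa ▸ hdom a) (hpb ▸ hdom b) hab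
    apply hinj
    rw [hpa, hpb, hyy]
  have hScard : S.card ≤ U.card := Finset.card_le_card_of_injOn _ hmaps hinjS
  -- (3) Gusfield/Dean with the width as base (Literature, layered form)
  have hU' : U.card ≤ Fintype.card V * (2 * Fintype.card V) ^ Nat.clog 2 T := by
    have hwid : ∀ L : ℕ, (Finset.univ.filter fun a : Fin (kk + 1) => (((e.symm a).1 : Fin (T + 1)) : ℕ) = L).card ≤
        Fintype.card V := card_layer_le e
    have hP := ParamDAG.Pmax_two_pow_le_of_isLayering (G := G) (lv := fun a => (((e.symm a).1 : Fin (T + 1)) : ℕ))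
      (layer_succ_of_adj lay e G hadj) hwid (Nat.clog 2 T)
    calc U.card ≤ ∑ x : V, (Envelope.pieceSlopes (G.W (e (0, v₀)) (e (Fin.last T, x)) (2 ^ Nat.clog 2 T))).card :=
          Finset.card_biUnion_le
      _ ≤ ∑ _x : V, (2 * Fintype.card V) ^ Nat.clog 2 T := by
          refine Finset.sum_le_sum fun x _ => ?_
          exact (ParamDAG.card_pieceSlopes_W_le_Pmax _ _ _).trans hP
      _ = Fintype.card V * (2 * Fintype.card V) ^ Nat.clog 2 T := by
          rw [Finset.sum_const, Finset.card_univ, smul_eq_mul]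
  -- (4) count
  have hsplit : S.card + S₀.card = n + 1 := by
    rw [hS, hS₀, Finset.card_filter_add_card_filter_not, Finset.card_univ, Fintype.card_fin]
  omega

/-- **Signed form (census currency `TropRootLawAt`)**: the same bound for sign-alternating dominant chains (alternating signs force distinct
consecutive terms). [folklore] -/
theorem chain_le_width_signed (hT : 0 < T) {n : ℕ} (θ : Fin (n + 1) → ℤ)
    (p : Fin (n + 1) → Equiv.Perm (Fin m) × (Fin m → Fin K)) (hθ : StrictMono θ)
    (hdom : ∀ k, IsDominant d (walkVal ι lay Ω v₀) (walkEps ι lay l₀ v₀) (θ k) (p k))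
    (halt : ∀ k : Fin n, termSign (walkEps ι lay l₀ v₀) (p k.castSucc) * termSign (walkEps ι lay l₀ v₀) (p k.succ) < 0) :
    n + 1 ≤ 1 + Fintype.card V * (2 * Fintype.card V) ^ Nat.clog 2 T := by
  refine chain_le_width lay d v₀ l₀ ι Ω hT θ p hθ hdom fun k h => ?_
  have := halt k
  rw [h] at this
  exact absurd this (not_lt.mpr (mul_self_nonneg _))

/-- **Width two is at most quadratic.**  In a walk design on at most two vertices per layer (`|V| ≤ 2`, rows `m ≤ 2(T+1)`), every chain
of dominant terms with distinct consecutive terms has `n ≤ 8·T²` — so no width-`≤ 2` walk family is super-quadratic (in particular none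
witnesses the cell's `K = 4` fork `¬ TropK4Law 2`), for every `K` and `d`. [folklore: `chain_le_width` + `2^⌈log₂ T⌉ ≤ 2T`] -/
theorem chain_le_of_width_le_two (hT : 0 < T) (hV : Fintype.card V ≤ 2) {n : ℕ} (θ : Fin (n + 1) → ℤ)
    (p : Fin (n + 1) → Equiv.Perm (Fin m) × (Fin m → Fin K)) (hθ : StrictMono θ)
    (hdom : ∀ k, IsDominant d (walkVal ι lay Ω v₀) (walkEps ι lay l₀ v₀) (θ k) (p k))
    (hne : ∀ k : Fin n, p k.castSucc ≠ p k.succ) : n ≤ 8 * T ^ 2 := by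
  have h := chain_le_width lay d v₀ l₀ ι Ω hT θ p hθ hdom hne
  set c := Nat.clog 2 T with hc
  -- `2^c ≤ 2T`
  have h2c : 2 ^ c ≤ 2 * T := by
    rcases Nat.lt_or_ge 1 T with hT1 | hT1
    · have hlt := Nat.pow_pred_clog_lt_self one_lt_two hT1
      have hcpos : 0 < c := Nat.clog_pos one_lt_two hT1
      have e : c = c.pred + 1 := (Nat.succ_pred_eq_of_pos hcpos).symm
      rw [← hc] at hlt
      rw [e, pow_succ]
      omega
    · have hT' : T = 1 := by omega
      subst hT'
      simp [hc]
  have hW : Fintype.card V * (2 * Fintype.card V) ^ c ≤ 2 * 4 ^ c := by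
    calc Fintype.card V * (2 * Fintype.card V) ^ c ≤ 2 * (2 * 2) ^ c :=
          Nat.mul_le_mul hV (Nat.pow_le_pow_left (by omega) c)
      _ = 2 * 4 ^ c := by norm_num
  have h4 : 4 ^ c = (2 ^ c) ^ 2 := by
    rw [← pow_mul, mul_comm, pow_mul]; norm_num
  have hsq : (2 ^ c) ^ 2 ≤ (2 * T) ^ 2 := Nat.pow_le_pow_left h2c 2
  rw [h4] at hW
  nlinarith

/-- **Polynomial form: width `≤ 2^a` gives exponent `a + 1`.**  In a walk design on at most `2^a` vertices per layer, every chain of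
dominant terms with distinct consecutive terms has `n ≤ 2^a · (2T)^(a+1)` — the `m`-exponent `1 + log₂ W` of `chain_le_width` as an
explicit polynomial (rows `m = (T+1)·|V|`), for every `K` and `d`. [folklore: `chain_le_width` + `2^⌈log₂ T⌉ ≤ 2T`] -/
theorem chain_le_pow_of_width_le_two_pow (hT : 0 < T) (a : ℕ) (hV : Fintype.card V ≤ 2 ^ a) {n : ℕ} (θ : Fin (n + 1) → ℤ)
    (p : Fin (n + 1) → Equiv.Perm (Fin m) × (Fin m → Fin K)) (hθ : StrictMono θ)
    (hdom : ∀ k, IsDominant d (walkVal ι lay Ω v₀) (walkEps ι lay l₀ v₀) (θ k) (p k))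
    (hne : ∀ k : Fin n, p k.castSucc ≠ p k.succ) : n ≤ 2 ^ a * (2 * T) ^ (a + 1) := by
  have h := chain_le_width lay d v₀ l₀ ι Ω hT θ p hθ hdom hne
  set c := Nat.clog 2 T with hc
  -- `2^c ≤ 2T`
  have h2c : 2 ^ c ≤ 2 * T := by
    rcases Nat.lt_or_ge 1 T with hT1 | hT1
    · have hlt := Nat.pow_pred_clog_lt_self one_lt_two hT1
      have hcpos : 0 < c := Nat.clog_pos one_lt_two hT1
      have e : c = c.pred + 1 := (Nat.succ_pred_eq_of_pos hcpos).symm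
      rw [← hc] at hlt
      rw [e, pow_succ]
      omega
    · have hT' : T = 1 := by omega
      subst hT'
      simp [hc]
  -- `|V|·(2|V|)^c ≤ 2^a · (2^(a+1))^c = 2^a · (2^c)^(a+1) ≤ 2^a · (2T)^(a+1)`
  have hW : Fintype.card V * (2 * Fintype.card V) ^ c ≤ 2 ^ a * (2 ^ (a + 1)) ^ c := by
    refine Nat.mul_le_mul hV (Nat.pow_le_pow_left ?_ c)
    rw [pow_succ]; omega
  have hswap : (2 ^ (a + 1)) ^ c = (2 ^ c) ^ (a + 1) := by rw [← pow_mul, ← pow_mul, mul_comm]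
  have hpow : (2 ^ c) ^ (a + 1) ≤ (2 * T) ^ (a + 1) := Nat.pow_le_pow_left h2c _
  rw [hswap] at hW
  have := Nat.mul_le_mul_left (2 ^ a) hpow
  omega

end Chains

end Summit.ValiantsHypothesis.ValiantsHypothesis.Theorems.KPlusLogSqLaw.WalkDesign
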